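import Mathlib.Analysis.SpecialFunctions.Pow.Asymptotics
import Mathlib.Analysis.SpecialFunctions.Log.Base
import Literature.NumberTheory.LFunctions.GaussianHeckeTauberian
import HarnessLib

/-!
# From prime powers to primes: `π_{ℤ[i]}(N) log N ∼ N` and `∑_{N(π) ≤ N} λ^m(π) = o(N / log N)`

Topic `Literature/NumberTheory/LFunctions`.  Seventh brick of the proof of Hecke's theorem on
Gaussian primes in sectors (`Literature.NumberTheory.LFunctions.GaussianInt.hecke_gaussianPrimes_inSectors`):
the elementary passage from the `ψ`-type sums of `GaussianHeckeTauberian.lean`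
(`∑_{N(π)^j ≤ N} log N(π) λ^m(π)^j`) to sums over PRIMES.  With `primesQ1 N` the first-quadrant
Gaussian primes of norm `≤ N` (one per prime ideal) we PROVE, along `N → ∞` in `ℕ`,

* `card_primesQ1_mul_log_sub_isLittleO` — **the prime ideal theorem for `ℤ[i]`**:
  `#(primesQ1 N) · log N - N = o(N)`, i.e. `π_{ℚ(i)}(N) ∼ N / log N`;
* `log_mul_sum_angularChar_isLittleO` — for `m ≥ 1`: **`log N · ∑_{π ∈ primesQ1 N} λ^m(π) = o(N)`**,
  i.e. `∑_{N(π) ≤ N} λ^m(π) = o(N / log N)` (Hecke 1920, §7).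

## Proof

(1) Prime powers with `j ≥ 2` and `N(π)^j ≤ N` have `N(π) ≤ √N` and `j ≤ log₂ N`; there are at most
`#{z : N(z) ≤ √N} · log₂ N ≤ 9 √N log₂ N` of them (`card_normLE_le`), so they contribute
`O(√N log² N) = o(N)` (`sum_lCoeff_sub_thetaSum_isLittleO`).  (2) With `Θ(N) = ∑_{N(π) ≤ N} log N(π)`
(`= N + o(N)`) and `D(N) = #(primesQ1 N) log N - Θ(N) = ∑_π (log N - log N(π)) ≥ 0`: splitting at
`y = N^{1-δ}` (`0 < δ ≤ 1/2`), `D(N) ≤ 9 y log N + 2δ Θ(N)`, which is `≤ ε N` for `δ` small and `N` large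
(`defect_le`, `defect_isLittleO`); and `|log N ∑_π λ^m(π) - ∑_π log N(π) λ^m(π)| ≤ D(N)`.

## References

* E. Hecke, *Eine neue Art von Zetafunktionen und ihre Beziehungen zur Verteilung der
  Primzahlen. II*, Math. Z. 6 (1920), 11–51, §7. [HeckeMathZ1920]
-/

noncomputable section

open Complex Filter Topology Asymptotics Finset

namespace Literature.NumberTheory.LFunctions

namespace GaussianHecke

open GaussianInt GaussianTheta

local notation "ℤ[i]" => _root_.GaussianInt

open scoped Classical

/-! ### Lattice points: `#{z : N(z) ≤ M} ≤ (2√M + 1)²` -/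

/-- `#{z ∈ ℤ[i] : N(z) ≤ M} ≤ (2 ⌊√M⌋ + 1)²` (the disc lies in the box `|re|, |im| ≤ √M`).
[folklore] -/
theorem card_normLE_le (M : ℕ) : (normLE (M : ℝ)).card ≤ (2 * Nat.sqrt M + 1) ^ 2 := by
  set s : ℕ := Nat.sqrt M
  have hsub : normLE (M : ℝ) ⊆ ((Icc (-(s : ℤ)) s) ×ˢ (Icc (-(s : ℤ)) s)).image
      fun ab : ℤ × ℤ ↦ (⟨ab.1, ab.2⟩ : ℤ[i]) := by
    intro z hz
    rw [mem_normLE] at hz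
    have hz' : z.norm ≤ M := by exact_mod_cast hz
    rw [Zsqrtd.norm_def] at hz'
    have hre : z.re.natAbs ≤ s := by
      rw [Nat.le_sqrt]
      have h1 : ((z.re.natAbs * z.re.natAbs : ℕ) : ℤ) ≤ M := by
        rw [Int.natAbs_mul_self]; nlinarith [mul_self_nonneg z.im]
      exact_mod_cast h1
    have him : z.im.natAbs ≤ s := by
      rw [Nat.le_sqrt]
      have h1 : ((z.im.natAbs * z.im.natAbs : ℕ) : ℤ) ≤ M := by
        rw [Int.natAbs_mul_self]; nlinarith [mul_self_nonneg z.re]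
      exact_mod_cast h1
    refine mem_image.mpr ⟨(z.re, z.im), mem_product.mpr ⟨mem_Icc.mpr ⟨?_, ?_⟩, mem_Icc.mpr ⟨?_, ?_⟩⟩,
      rfl⟩ <;> omega
  refine (card_le_card hsub).trans (card_image_le.trans ?_)
  rw [card_product, Int.card_Icc, show (s : ℤ) + 1 - -(s : ℤ) = ((2 * s + 1 : ℕ) : ℤ) by push_cast; ring,
    Int.toNat_natCast, sq]

/-- `#{z : N(z) ≤ M} ≤ 9 M` for `M ≥ 1`. [folklore] -/
theorem card_normLE_le_nine_mul {M : ℕ} (hM : 1 ≤ M) : ((normLE (M : ℝ)).card : ℝ) ≤ 9 * M := by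
  have h := card_normLE_le M
  have hs : 1 ≤ Nat.sqrt M := Nat.le_sqrt.mpr (by omega)
  have hss : Nat.sqrt M * Nat.sqrt M ≤ M := Nat.sqrt_le M
  have : (2 * Nat.sqrt M + 1) ^ 2 ≤ 9 * M := by nlinarith
  exact_mod_cast h.trans this

/-- `#(primesQ1 M) ≤ #{z : N(z) ≤ M}`. [folklore] -/
theorem card_primesQ1_le (M : ℕ) : (primesQ1 M).card ≤ (normLE (M : ℝ)).card :=
  card_le_card (filter_subset _ _)

/-! ### `ψ`-sums versus `θ`-sums: prime powers `j ≥ 2` are negligible -/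

/-- The prime-power pairs `(π, j)` with `N(π)^j ≤ N`. [folklore] -/
def ppairs (N : ℕ) : Finset (ℤ[i] × ℕ) :=
  (primesQ1 N ×ˢ Icc 1 N).filter fun p ↦ p.1.norm.natAbs ^ p.2 ≤ N

/-- Membership in `ppairs`. [folklore] -/
theorem mem_ppairs {N : ℕ} {p : ℤ[i] × ℕ} :
    p ∈ ppairs N ↔ p.1 ∈ primesQ1 N ∧ p.2 ∈ Icc 1 N ∧ p.1.norm.natAbs ^ p.2 ≤ N := by
  rw [ppairs, mem_filter, mem_product, and_assoc]

/-- `ψ_m(N) = ∑_{n ≤ N} l_m(n) = ∑_{(π,j) : N(π)^j ≤ N} log N(π) λ^m(π)^j`. [folklore] -/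
theorem sum_lCoeff_eq_sum_ppairs (m N : ℕ) :
    ∑ n ∈ Icc 1 N, lCoeff m n =
      ∑ p ∈ ppairs N, (Real.log (p.1.norm : ℝ) : ℂ) * angularChar m p.1 ^ p.2 := by
  have hmaps : ∀ p ∈ ppairs N, p.1.norm.natAbs ^ p.2 ∈ Icc 1 N := by
    intro p hp
    obtain ⟨hπ, hj, hle⟩ := mem_ppairs.mp hp
    refine mem_Icc.mpr ⟨Nat.one_le_pow _ _ ?_, hle⟩
    have := two_le_norm_of_prime (mem_primesQ1.mp hπ).1
    have := natAbs_norm_cast p.1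
    omega
  rw [← sum_fiberwise_of_maps_to hmaps]
  refine sum_congr rfl fun n hn ↦ ?_
  rw [lCoeff]
  congr 1
  ext p
  obtain ⟨hn1, hnN⟩ := mem_Icc.mp hn
  rw [mem_filter, mem_ppairs, mem_pairsNorm]
  constructor
  · rintro ⟨hπ, hj, hpn⟩
    obtain ⟨hP, hQ, hle⟩ := mem_primesQ1.mp hπ
    obtain ⟨hj1, hjn⟩ := mem_Icc.mp hj
    exact ⟨⟨mem_primesQ1.mpr ⟨hP, hQ, hle.trans (by exact_mod_cast hnN)⟩,
      mem_Icc.mpr ⟨hj1, hjn.trans hnN⟩, hpn ▸ hnN⟩, hpn⟩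
  · rintro ⟨⟨hπ, hj, -⟩, hpn⟩
    obtain ⟨hP, hQ, -⟩ := mem_primesQ1.mp hπ
    have key := mem_pairsNorm.mp (mem_pairsNorm_of hP hQ (mem_Icc.mp hj).1)
    rw [hpn] at key
    exact ⟨key.1, key.2.1, hpn⟩

/-- `θ_m(N) = ∑_{π ∈ primesQ1 N} log N(π) λ^m(π)`. [folklore] -/
def thetaSum (m N : ℕ) : ℂ := ∑ π ∈ primesQ1 N, (Real.log (π.norm : ℝ) : ℂ) * angularChar m π

/-- The `j = 1` slice of `ppairs N` gives `θ_m(N)`. [folklore] -/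
theorem sum_ppairs_filter_eq_thetaSum (m N : ℕ) :
    ∑ p ∈ (ppairs N).filter (fun p ↦ p.2 = 1), (Real.log (p.1.norm : ℝ) : ℂ) * angularChar m p.1 ^ p.2 =
      thetaSum m N := by
  rw [thetaSum]
  refine sum_nbij' (fun p ↦ p.1) (fun π ↦ (π, 1)) ?_ ?_ ?_ ?_ ?_
  · intro p hp
    exact (mem_ppairs.mp (mem_filter.mp hp).1).1
  · intro π hπ
    obtain ⟨hP, hQ, hle⟩ := mem_primesQ1.mp hπ
    have hN : 1 ≤ N := by
      have := two_le_norm_of_prime hP; omega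
    refine mem_filter.mpr ⟨mem_ppairs.mpr ⟨hπ, mem_Icc.mpr ⟨le_rfl, hN⟩, ?_⟩, rfl⟩
    have := natAbs_norm_cast π
    show π.norm.natAbs ^ 1 ≤ N
    rw [pow_one]; omega
  · rintro ⟨π, j⟩ hp
    have hj : j = 1 := (mem_filter.mp hp).2
    simp [hj]
  · intro π _; rfl
  · rintro ⟨π, j⟩ hp
    have hj : j = 1 := (mem_filter.mp hp).2
    simp [hj]

/-- Pairs with `j ≥ 2` inject into `primesQ1 ⌊√N⌋ × [2, log₂ N]`. [folklore] -/
theorem ppairs_filter_subset (N : ℕ) :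
    (ppairs N).filter (fun p ↦ p.2 ≠ 1) ⊆ primesQ1 (Nat.sqrt N) ×ˢ Icc 2 (Nat.log 2 N) := by
  intro p hp
  obtain ⟨hp, hj1⟩ := mem_filter.mp hp
  obtain ⟨hπ, hj, hle⟩ := mem_ppairs.mp hp
  obtain ⟨hP, hQ, -⟩ := mem_primesQ1.mp hπ
  have hj2 : 2 ≤ p.2 := by have := (mem_Icc.mp hj).1; omega
  have h2 : 2 ≤ p.1.norm.natAbs := by
    have := two_le_norm_of_prime hP; have := natAbs_norm_cast p.1; omega
  refine mem_product.mpr ⟨mem_primesQ1.mpr ⟨hP, hQ, ?_⟩, mem_Icc.mpr ⟨hj2, ?_⟩⟩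
  · -- `N(π)² ≤ N(π)^j ≤ N`, so `N(π) ≤ √N`
    have hsq : p.1.norm.natAbs * p.1.norm.natAbs ≤ N :=
      le_trans (by rw [← sq]; exact Nat.pow_le_pow_right (by omega) hj2) hle
    have := Nat.le_sqrt.mpr hsq
    have := natAbs_norm_cast p.1
    calc p.1.norm = (p.1.norm.natAbs : ℤ) := (natAbs_norm_cast p.1).symm
      _ ≤ Nat.sqrt N := by exact_mod_cast Nat.le_sqrt.mpr hsq
  · exact Nat.le_log_of_pow_le one_lt_two ((Nat.pow_le_pow_left h2 p.2).trans hle)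

/-- `‖ψ_m(N) - θ_m(N)‖ ≤ 9 √N · log₂ N · log N`. [folklore] -/
theorem norm_sum_lCoeff_sub_thetaSum_le (m : ℕ) {N : ℕ} (hN : 1 ≤ N) :
    ‖∑ n ∈ Icc 1 N, lCoeff m n - thetaSum m N‖ ≤ 9 * Nat.sqrt N * Nat.log 2 N * Real.log N := by
  rw [sum_lCoeff_eq_sum_ppairs, ← sum_ppairs_filter_eq_thetaSum m N,
    ← sum_filter_add_sum_filter_not (ppairs N) (fun p ↦ p.2 = 1), add_sub_cancel_left]
  have hbound : ∀ p ∈ (ppairs N).filter (fun p ↦ ¬p.2 = 1),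
      ‖(Real.log (p.1.norm : ℝ) : ℂ) * angularChar m p.1 ^ p.2‖ ≤ Real.log N := by
    intro p hp
    obtain ⟨hπ, -, hle⟩ := mem_ppairs.mp (mem_filter.mp hp).1
    obtain ⟨hP, -, hleN⟩ := mem_primesQ1.mp hπ
    have h1 : (1 : ℝ) ≤ (p.1.norm : ℝ) := by
      have := two_le_norm_of_prime hP; exact_mod_cast (by omega : (1 : ℤ) ≤ p.1.norm)
    rw [norm_mul, norm_pow, norm_angularChar hP.ne_zero, one_pow, mul_one, Complex.norm_real,
      Real.norm_of_nonneg (Real.log_nonneg h1)]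
    exact Real.log_le_log (by linarith) (by exact_mod_cast hleN)
  calc ‖∑ p ∈ (ppairs N).filter (fun p ↦ ¬p.2 = 1), (Real.log (p.1.norm : ℝ) : ℂ) * angularChar m p.1 ^ p.2‖
      ≤ ∑ p ∈ (ppairs N).filter (fun p ↦ ¬p.2 = 1), Real.log N := (norm_sum_le _ _).trans (sum_le_sum hbound)
    _ = ((ppairs N).filter (fun p ↦ ¬p.2 = 1)).card * Real.log N := by rw [sum_const, nsmul_eq_mul]
    _ ≤ (9 * Nat.sqrt N * Nat.log 2 N) * Real.log N := by
        refine mul_le_mul_of_nonneg_right ?_ (Real.log_natCast_nonneg N)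
        have hsub := ppairs_filter_subset N
        have hc := (card_le_card hsub).trans_eq (card_product _ _)
        rw [Nat.card_Icc] at hc
        have hq : ((primesQ1 (Nat.sqrt N)).card : ℝ) ≤ 9 * Nat.sqrt N :=
          (Nat.cast_le.mpr (card_primesQ1_le _)).trans
            (card_normLE_le_nine_mul (Nat.le_sqrt.mpr (by omega)))
        have hl : ((Nat.log 2 N + 1 - 2 : ℕ) : ℝ) ≤ Nat.log 2 N := by
          norm_cast
          omega
        calc (((ppairs N).filter (fun p ↦ ¬p.2 = 1)).card : ℝ)
            ≤ (primesQ1 (Nat.sqrt N)).card * ((Nat.log 2 N + 1 - 2 : ℕ) : ℝ) := by exact_mod_cast hc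
          _ ≤ (9 * Nat.sqrt N) * Nat.log 2 N :=
              mul_le_mul hq hl (Nat.cast_nonneg _) (by positivity)

/-- `√N · log₂ N · log N = o(N)`. [folklore] -/
theorem sqrt_mul_log_mul_log_isLittleO :
    (fun N : ℕ ↦ (9 * Nat.sqrt N * Nat.log 2 N * Real.log N : ℝ)) =o[atTop] fun N : ℕ ↦ (N : ℝ) := by
  -- compare with `√N (log N)² / log 2` and use `log x = o(x^{1/4})`
  have hlog : (fun x : ℝ ↦ Real.log x) =o[atTop] fun x : ℝ ↦ x ^ (1 / 4 : ℝ) :=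
    isLittleO_log_rpow_atTop (by norm_num)
  have hlog2 : (fun x : ℝ ↦ Real.log x ^ 2) =o[atTop] fun x : ℝ ↦ x ^ (1 / 2 : ℝ) := by
    have := hlog.mul hlog
    refine (this.congr' (Eventually.of_forall fun x ↦ (sq _).symm) ?_)
    filter_upwards [eventually_ge_atTop 0] with x hx
    rw [← Real.rpow_add' hx (by norm_num)]; norm_num
  have hprod : (fun x : ℝ ↦ x ^ (1 / 2 : ℝ) * Real.log x ^ 2) =o[atTop] fun x : ℝ ↦ x := by
    have := (isBigO_refl (fun x : ℝ ↦ x ^ (1 / 2 : ℝ)) atTop).mul_isLittleO hlog2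
    refine this.congr' EventuallyEq.rfl ?_
    filter_upwards [eventually_ge_atTop 0] with x hx
    rw [← Real.rpow_add' hx (by norm_num)]; norm_num
  have hnat := hprod.comp_tendsto tendsto_natCast_atTop_atTop
  refine IsBigO.trans_isLittleO ?_ hnat
  refine IsBigO.of_bound (9 / Real.log 2) ?_
  filter_upwards [eventually_ge_atTop 1] with N hN
  have hlog2pos : 0 < Real.log 2 := Real.log_pos one_lt_two
  have hsqrt : (Nat.sqrt N : ℝ) ≤ (N : ℝ) ^ (1 / 2 : ℝ) := by
    rw [← Real.sqrt_eq_rpow]; exact Real.nat_sqrt_le_real_sqrt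
  have hlogN : 0 ≤ Real.log N := Real.log_natCast_nonneg N
  have hNlog : (Nat.log 2 N : ℝ) ≤ Real.log N / Real.log 2 := by
    rw [← Real.natFloor_logb_natCast 2 N, Real.log_div_log]
    exact Nat.floor_le (Real.logb_nonneg one_lt_two (by exact_mod_cast hN))
  simp only [Function.comp_apply, Real.norm_eq_abs]
  rw [abs_of_nonneg (by positivity), abs_of_nonneg (by positivity)]
  calc (9 : ℝ) * Nat.sqrt N * Nat.log 2 N * Real.log N
      ≤ 9 * (N : ℝ) ^ (1 / 2 : ℝ) * (Real.log N / Real.log 2) * Real.log N := by gcongr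
    _ = 9 / Real.log 2 * ((N : ℝ) ^ (1 / 2 : ℝ) * Real.log N ^ 2) := by
        field_simp

/-- **`ψ_m(N) - θ_m(N) = o(N)`**: prime powers with exponent `≥ 2` are negligible. [folklore] -/
theorem sum_lCoeff_sub_thetaSum_isLittleO (m : ℕ) :
    (fun N : ℕ ↦ ∑ n ∈ Icc 1 N, lCoeff m n - thetaSum m N) =o[atTop] fun N : ℕ ↦ (N : ℝ) := by
  refine IsBigO.trans_isLittleO ?_ sqrt_mul_log_mul_log_isLittleO
  refine IsBigO.of_bound 1 ?_
  filter_upwards [eventually_ge_atTop 1] with N hN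
  rw [one_mul, Real.norm_of_nonneg (by positivity)]
  exact norm_sum_lCoeff_sub_thetaSum_le m hN

/-- **`θ_m(N) = o(N)` for `m ≥ 1`.** [cite: HeckeMathZ1920, §7] -/
theorem thetaSum_isLittleO {m : ℕ} (hm : m ≠ 0) :
    (fun N : ℕ ↦ thetaSum m N) =o[atTop] fun N : ℕ ↦ (N : ℝ) := by
  have h := (sum_lCoeff_isLittleO hm).sub (sum_lCoeff_sub_thetaSum_isLittleO m)
  exact h.congr' (Eventually.of_forall fun N ↦ by simp) EventuallyEq.rfl

/-- The real Chebyshev function of `ℤ[i]`: `Θ(N) = ∑_{π ∈ primesQ1 N} log N(π)`. [folklore] -/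
def thetaReal (N : ℕ) : ℝ := ∑ π ∈ primesQ1 N, Real.log (π.norm : ℝ)

/-- `Θ(N) = Re θ_0(N)`. [folklore] -/
theorem thetaReal_eq_re (N : ℕ) : thetaReal N = (thetaSum 0 N).re := by
  rw [thetaReal, thetaSum, re_sum]
  refine sum_congr rfl fun π _ ↦ ?_
  rw [angularChar_zero_left, mul_one, ofReal_re]

/-- **`Θ(N) - N = o(N)`** (the prime ideal theorem for `ℤ[i]` in `θ`-form). [folklore] -/
theorem thetaReal_sub_isLittleO :
    (fun N : ℕ ↦ thetaReal N - N) =o[atTop] fun N : ℕ ↦ (N : ℝ) := by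
  have h1 : (fun N : ℕ ↦ (thetaSum 0 N - ∑ n ∈ Icc 1 N, lCoeff 0 n).re) =o[atTop]
      fun N : ℕ ↦ (N : ℝ) := by
    refine IsBigO.trans_isLittleO (IsBigO.of_bound 1 (Eventually.of_forall fun N ↦ ?_))
      (sum_lCoeff_sub_thetaSum_isLittleO 0)
    rw [one_mul, Real.norm_eq_abs]
    exact (abs_re_le_norm _).trans_eq (norm_sub_rev _ _)
  refine (h1.add sum_re_lCoeff_zero_sub_isLittleO).congr' (Eventually.of_forall fun N ↦ ?_)
    EventuallyEq.rfl
  simp only [thetaReal_eq_re, sub_re, re_sum]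
  ring

/-! ### From `θ` to `π log`: the defect `D(N) = #(primesQ1 N) log N - Θ(N)` is `o(N)` -/

/-- `D(N) = #(primesQ1 N) · log N - Θ(N) = ∑_π (log N - log N(π))`. [folklore] -/
def defect (N : ℕ) : ℝ := (primesQ1 N).card * Real.log N - thetaReal N

/-- `D(N)` as a sum of the nonnegative terms `log N - log N(π)`. [folklore] -/
theorem defect_eq_sum (N : ℕ) :
    defect N = ∑ π ∈ primesQ1 N, (Real.log N - Real.log (π.norm : ℝ)) := by
  rw [defect, thetaReal, sum_sub_distrib, sum_const, nsmul_eq_mul]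

/-- Each term `log N - log N(π)`, `π ∈ primesQ1 N`, is nonnegative. [folklore] -/
theorem log_sub_log_nonneg {N : ℕ} {π : ℤ[i]} (hπ : π ∈ primesQ1 N) :
    0 ≤ Real.log N - Real.log (π.norm : ℝ) := by
  obtain ⟨hP, -, hle⟩ := mem_primesQ1.mp hπ
  have h2 := two_le_norm_of_prime hP
  have h0 : (0 : ℝ) < (π.norm : ℝ) := by exact_mod_cast (by omega : (0 : ℤ) < π.norm)
  exact sub_nonneg.mpr (Real.log_le_log h0 (by exact_mod_cast hle))

/-- **The key estimate**: for `0 < δ ≤ 1/2` and `N ≥ 2`,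
`D(N) ≤ 9 N^{1-δ} log N + 2δ Θ(N)` (split the primes at `N(π) ≤ y = N^{1-δ}`: below, at most
`#{z : N(z) ≤ y} ≤ 9y` primes each contributing `≤ log N`; above, each contributes `≤ log N - log y
= δ log N` and there are at most `Θ(N)/log y` of them). [folklore] -/
theorem defect_le {δ : ℝ} (hδ : 0 < δ) (hδ2 : δ ≤ 1 / 2) {N : ℕ} (hN : 2 ≤ N) :
    defect N ≤ 9 * (N : ℝ) ^ (1 - δ) * Real.log N + 2 * δ * thetaReal N := by
  set y : ℝ := (N : ℝ) ^ (1 - δ) with hy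
  have hN0 : (0 : ℝ) < N := by exact_mod_cast (by omega : 0 < N)
  have hN1 : (1 : ℝ) < N := by exact_mod_cast (by omega : 1 < N)
  have hlogN : 0 < Real.log N := Real.log_pos hN1
  have hy1 : 1 ≤ y := Real.one_le_rpow hN1.le (by linarith)
  have hlogy : Real.log y = (1 - δ) * Real.log N := by rw [hy, Real.log_rpow hN0]
  have hlogy0 : 0 < Real.log y := by rw [hlogy]; exact mul_pos (by linarith) hlogN
  rw [defect_eq_sum, ← sum_filter_add_sum_filter_not (primesQ1 N) (fun π ↦ (π.norm : ℝ) ≤ y)]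
  -- small primes
  have hA : ∑ π ∈ (primesQ1 N).filter (fun π ↦ (π.norm : ℝ) ≤ y), (Real.log N - Real.log (π.norm : ℝ))
      ≤ 9 * y * Real.log N := by
    have hcard : (((primesQ1 N).filter (fun π ↦ (π.norm : ℝ) ≤ y)).card : ℝ) ≤ 9 * y := by
      have hfl : 1 ≤ ⌊y⌋₊ := Nat.le_floor (by exact_mod_cast hy1)
      have hsub : (primesQ1 N).filter (fun π ↦ (π.norm : ℝ) ≤ y) ⊆ normLE ((⌊y⌋₊ : ℕ) : ℝ) := by
        intro π hπ
        obtain ⟨-, hπy⟩ := mem_filter.mp hπ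
        rw [mem_normLE]
        have h1 : ((π.norm.natAbs : ℕ) : ℝ) ≤ y := by rwa [natAbs_norm_real]
        have h2 : π.norm.natAbs ≤ ⌊y⌋₊ := Nat.le_floor h1
        rw [← natAbs_norm_real]
        exact_mod_cast h2
      calc (((primesQ1 N).filter (fun π ↦ (π.norm : ℝ) ≤ y)).card : ℝ)
          ≤ (normLE ((⌊y⌋₊ : ℕ) : ℝ)).card := by exact_mod_cast card_le_card hsub
        _ ≤ 9 * (⌊y⌋₊ : ℝ) := card_normLE_le_nine_mul hfl
        _ ≤ 9 * y := by gcongr; exact Nat.floor_le (by linarith)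
    calc ∑ π ∈ (primesQ1 N).filter (fun π ↦ (π.norm : ℝ) ≤ y), (Real.log N - Real.log (π.norm : ℝ))
        ≤ ∑ π ∈ (primesQ1 N).filter (fun π ↦ (π.norm : ℝ) ≤ y), Real.log N := by
          refine sum_le_sum fun π hπ ↦ ?_
          have h0 := log_sub_log_nonneg (mem_filter.mp hπ).1
          obtain ⟨hP, -, -⟩ := mem_primesQ1.mp (mem_filter.mp hπ).1
          have : 0 ≤ Real.log (π.norm : ℝ) := Real.log_nonneg (by
            have := two_le_norm_of_prime hP; exact_mod_cast (by omega : (1 : ℤ) ≤ π.norm))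
          linarith
      _ = ((primesQ1 N).filter (fun π ↦ (π.norm : ℝ) ≤ y)).card * Real.log N := by
          rw [sum_const, nsmul_eq_mul]
      _ ≤ 9 * y * Real.log N := by gcongr
  -- large primes
  have hB : ∑ π ∈ (primesQ1 N).filter (fun π ↦ ¬(π.norm : ℝ) ≤ y), (Real.log N - Real.log (π.norm : ℝ))
      ≤ 2 * δ * thetaReal N := by
    set B := (primesQ1 N).filter (fun π ↦ ¬(π.norm : ℝ) ≤ y) with hBdef
    have hterm : ∀ π ∈ B, Real.log N - Real.log (π.norm : ℝ) ≤ δ * Real.log N := by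
      intro π hπ
      have hπy : y < (π.norm : ℝ) := lt_of_not_ge (mem_filter.mp hπ).2
      have : Real.log y ≤ Real.log (π.norm : ℝ) := Real.log_le_log (by linarith) hπy.le
      rw [hlogy] at this
      nlinarith
    have hcardB : (B.card : ℝ) * Real.log y ≤ thetaReal N := by
      calc (B.card : ℝ) * Real.log y = ∑ π ∈ B, Real.log y := by rw [sum_const, nsmul_eq_mul]
        _ ≤ ∑ π ∈ B, Real.log (π.norm : ℝ) := sum_le_sum fun π hπ ↦
            Real.log_le_log (by linarith) (lt_of_not_ge (mem_filter.mp hπ).2).le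
        _ ≤ thetaReal N := by
            rw [thetaReal]
            refine sum_le_sum_of_subset_of_nonneg (filter_subset _ _) fun π hπ _ ↦ ?_
            obtain ⟨hP, -, -⟩ := mem_primesQ1.mp hπ
            exact Real.log_nonneg (by
              have := two_le_norm_of_prime hP; exact_mod_cast (by omega : (1 : ℤ) ≤ π.norm))
    have hX : (B.card : ℝ) * Real.log N ≤ 2 * thetaReal N := by
      rw [hlogy] at hcardB
      have hX0 : 0 ≤ (B.card : ℝ) * Real.log N := by positivity
      nlinarith
    calc ∑ π ∈ B, (Real.log N - Real.log (π.norm : ℝ)) ≤ ∑ π ∈ B, δ * Real.log N := sum_le_sum hterm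
      _ = δ * (B.card * Real.log N) := by rw [sum_const, nsmul_eq_mul]; ring
      _ ≤ δ * (2 * thetaReal N) := mul_le_mul_of_nonneg_left hX hδ.le
      _ = 2 * δ * thetaReal N := by ring
  linarith

/-- **`D(N) = o(N)`**: `#(primesQ1 N) log N - Θ(N) = o(N)`. [folklore] -/
theorem defect_isLittleO : (fun N : ℕ ↦ defect N) =o[atTop] fun N : ℕ ↦ (N : ℝ) := by
  rw [isLittleO_iff]
  intro ε hε
  set δ : ℝ := min (1 / 2) (ε / 8) with hδdef
  have hδ : 0 < δ := lt_min (by norm_num) (by linarith)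
  have hδ2 : δ ≤ 1 / 2 := min_le_left _ _
  have hδε : δ ≤ ε / 8 := min_le_right _ _
  -- `Θ(N) ≤ 2N` eventually
  have hθ : ∀ᶠ N : ℕ in atTop, thetaReal N ≤ 2 * N := by
    have := (thetaReal_sub_isLittleO.def one_pos)
    filter_upwards [this] with N hN
    rw [one_mul, Real.norm_of_nonneg (Nat.cast_nonneg N), Real.norm_eq_abs] at hN
    linarith [(abs_le.mp hN).2]
  -- `log N ≤ (ε/18) N^δ` eventually
  have hlog : ∀ᶠ N : ℕ in atTop, Real.log N ≤ ε / 18 * (N : ℝ) ^ δ := by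
    have h := ((isLittleO_log_rpow_atTop hδ).comp_tendsto tendsto_natCast_atTop_atTop).def
      (by positivity : 0 < ε / 18)
    filter_upwards [h] with N hN
    simp only [Function.comp_apply, Real.norm_eq_abs] at hN
    rw [abs_of_nonneg (Real.log_natCast_nonneg N),
      abs_of_nonneg (Real.rpow_nonneg (Nat.cast_nonneg N) δ)] at hN
    exact hN
  filter_upwards [hθ, hlog, eventually_ge_atTop 2] with N hθN hlogN hN2
  have hN0 : (0 : ℝ) < N := by exact_mod_cast (by omega : 0 < N)
  have hD0 : 0 ≤ defect N := by rw [defect_eq_sum]; exact sum_nonneg fun π hπ ↦ log_sub_log_nonneg hπ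
  rw [Real.norm_of_nonneg hD0, Real.norm_of_nonneg hN0.le]
  have hsplit : (N : ℝ) ^ (1 - δ) * (N : ℝ) ^ δ = N := by
    rw [← Real.rpow_add hN0]; norm_num
  calc defect N ≤ 9 * (N : ℝ) ^ (1 - δ) * Real.log N + 2 * δ * thetaReal N := defect_le hδ hδ2 hN2
    _ ≤ 9 * (N : ℝ) ^ (1 - δ) * (ε / 18 * (N : ℝ) ^ δ) + 2 * δ * (2 * N) := by gcongr
    _ = ε / 2 * N + 4 * δ * N := by
        rw [show 9 * (N : ℝ) ^ (1 - δ) * (ε / 18 * (N : ℝ) ^ δ) = ε / 2 * ((N : ℝ) ^ (1 - δ) * (N : ℝ) ^ δ)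
          by ring, hsplit]
        ring
    _ ≤ ε * N := by nlinarith

/-! ### Conclusions -/

/-- **Prime ideal theorem for `ℚ(i)`**: `#(primesQ1 N) · log N - N = o(N)`, i.e. the number of
prime ideals of `ℤ[i]` of norm `≤ N` is `∼ N / log N` (Landau 1903; here from Hecke's `L`-functions
via Wiener–Ikehara). [cite: HeckeMathZ1920, §7] -/
theorem card_primesQ1_mul_log_sub_isLittleO :
    (fun N : ℕ ↦ (primesQ1 N).card * Real.log N - N) =o[atTop] fun N : ℕ ↦ (N : ℝ) := by
  refine (defect_isLittleO.add thetaReal_sub_isLittleO).congr' (Eventually.of_forall fun N ↦ ?_)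
    EventuallyEq.rfl
  simp only [defect]
  ring

/-- **`log N · ∑_{π ∈ primesQ1 N} λ^m(π) = o(N)` for `m ≥ 1`**, i.e.
`∑_{N(π) ≤ N} λ^m(π) = o(N / log N) = o(π_{ℚ(i)}(N))`: the angles `4m·arg π` of the Gaussian
primes have mean zero (Hecke 1920, §7). [cite: HeckeMathZ1920, §7] -/
theorem log_mul_sum_angularChar_isLittleO {m : ℕ} (hm : m ≠ 0) :
    (fun N : ℕ ↦ (Real.log N : ℂ) * ∑ π ∈ primesQ1 N, angularChar m π) =o[atTop]
      fun N : ℕ ↦ (N : ℝ) := by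
  have hdiff : (fun N : ℕ ↦ (Real.log N : ℂ) * ∑ π ∈ primesQ1 N, angularChar m π - thetaSum m N)
      =o[atTop] fun N : ℕ ↦ (N : ℝ) := by
    refine IsBigO.trans_isLittleO (IsBigO.of_bound 1 (Eventually.of_forall fun N ↦ ?_)) defect_isLittleO
    have hD0 : 0 ≤ defect N := by
      rw [defect_eq_sum]; exact sum_nonneg fun π hπ ↦ log_sub_log_nonneg hπ
    rw [one_mul, Real.norm_of_nonneg hD0, thetaSum, mul_sum, ← sum_sub_distrib, defect_eq_sum]
    refine (norm_sum_le _ _).trans (sum_le_sum fun π hπ ↦ ?_)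
    obtain ⟨hP, -, -⟩ := mem_primesQ1.mp hπ
    rw [← sub_mul, norm_mul, norm_angularChar hP.ne_zero, mul_one, ← ofReal_sub, Complex.norm_real,
      Real.norm_of_nonneg (log_sub_log_nonneg hπ)]
  have h := hdiff.add (thetaSum_isLittleO hm)
  exact h.congr' (Eventually.of_forall fun N ↦ by simp) EventuallyEq.rfl

end GaussianHecke

end Literature.NumberTheory.LFunctions
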